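import Summits.BirchSwinnertonDyer.BirchSwinnertonDyer.Theorems.KolyvaginDepthDoorDepthTableKuriharaDecisivePrime
import Summits.BirchSwinnertonDyer.BirchSwinnertonDyer.Theorems.KolyvaginDepthDoorDepthTableKuriharaExactRow
import Summits.BirchSwinnertonDyer.BirchSwinnertonDyer.Theorems.KolyvaginDepthDoorDepthTableKuriharaSocket655a1
import Summits.BirchSwinnertonDyer.BirchSwinnertonDyer.Theorems.KolyvaginDepthDoorDepthTableRow655a1RankDischarged
import Summits.BirchSwinnertonDyer.Rank1Residual.Supersingular.CountPointsFast
import HarnessLib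

/-!
# Route `KolyvaginDepthDoor`, crux `KolyvaginDepthSupplyKN` (stmt-BirchSwinnertonDyer-22820) —
# DEPTH TABLE v20, ROW `655a1` @ `(11, d_K = -51)`: the EXACT depth-one reading at `11` and THE DECISIVE PRIME `ℓ★ = 89`
# — the row's bit ⟺ a unit mod-`11` Kurihara number of the twist model `T₀ = [0, 0, 1, -33813, -2420881]` AT THE ONE PRIME
# `89` (kernel: `9 • P̄ ≠ O` in `T̃₀(𝔽_89)` for the tree's twist point `P = (3844729/16, 7538734893/64)`, `#T̃₀(𝔽_89) = 99 = 11·9`)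

Helper file of the lead prover of line `levelone` (kdd-p1 g24; `--supports stmt-BirchSwinnertonDyer-22820
--as helper`); it closes nothing and BSD is NOT proved by it. Same template as `…KuriharaSocket681c1` (exact reading) and
`…KuriharaDecisive681c1` (decisive prime, rational-point bridge).

v19 (g23, `…KuriharaSocket655a1`) gave this row a SOCKET only — «no exact depth-one reading here» and, in CLOSING-DATA-v19,
«no rational point of small height found on `T₀`» — so `655a1` was one of five rows without a decisive prime. Both gaps
close from material ALREADY IN THE TREE: (i) `rank 655a1 = 2` IS a kernel theorem (`Rank2Observatory.C655a1.mordellWeilRank_eq_two`,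
general 2-descent, g17-era) and the E-side `Ш(655a1)[11] = 0` from the record `cert_655a1` @ `(11, 617·727)` is g21's
`C655a1.sha_inf_torsionBy_eq_bot_of_kuriharaClaim_11`, so g14's generic rank-two row
`kolyvaginClass_prime_ne_zero_iff_shaTrivial_twistSelmer_of_rank_two_of_lemma84` ((γ) + W. Zhang L8.4 (1) by name) ∘ v18's
twist IFF `natCard_selmerGroup_quadraticTwist_le_iff_kuriharaBit` (Sakamoto Thm. 1.2/1.5 + Kim Thm. 1.11 by name) give the exact
reading at `(11, −51)` verbatim as for `681c1`; (ii) the kernel twist point of the v12 table (g16, `C655a1.one_le_rank_twist_neg51`: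
`(3844729/4, 7538734925/8)` on the `u = 1/2` model `[0, 0, 0, -541008, -154936368]`) transports to `P = (3844729/16, 7538734893/64)`
on the minimal model `T₀` (`x = X/4`, `y = Y/8 − 1/2`; denominators `2⁴`, `2⁶`), and at the least cyclic Kolyvagin prime `89` of
`(T₀, 11)` (`#T̃₀(𝔽_89) = 99`, `a_89 = −9 ≡ 2 (mod 11)`) its reduction `P̄ = (79, 2)` has `9 • P̄ = (59, 74) ≠ O` (4-step chain,
`decide`), so `P ∉ 11·T₀(ℚ_89)` by the rational bridge `localNondivisible_of_chainB_rat`. HENCE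

* `kolyvaginPrime_iff_twistKuriharaBit_11_neg51` — **THE EXACT DEPTH-ONE READING** at `(11, −51)`: bit ⟺ «for every admissible
  datum of `T₀`, some cyclic Kolyvagin level of `(T₀, 11)` of depth `≤ 1` carries a unit mod-`11` Kurihara number».
* `twistKuriharaBit_iff_unit_89` — **bit ⟺ unit `δ̃_89(T₀)`**: the fleet's ONE residue `δ̃_89(T₀) mod 11` DECIDES the row
  `655a1` @ `(11, −51)` BOTH WAYS modulo print (a computed ZERO refutes the clause at `(11, ℚ(√−51))`, a UNIT proves it via the socket).
  `N_{T₀} = 1703655`; `89` is the smallest cyclic Kolyvagin prime of `(T₀, 11)` (then `617, 727, 947, 1409, 2003`, all ★ for `P`).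

Kernel lemmas: `minTwist51_card_89`, `minTwist51_isCyclicKolyvaginLevel_11_89`, `minTwist51_nonsingular_P`, `chain89_mult/_ok`,
`minTwist51_localNondivisible_89`. CONDITIONAL on the named facts displayed and the E-side record claim `hδE`; per curve; nothing
class-wide; BSD is NOT proved by any of this.

References: [Sakamoto2022pSelmer] Lemma 4.4, Lemma 4.6 (1), Thm. 1.2, Thm. 1.5; [Kim2022StructureSelmer] Thm. 1.11, §1.2.2;
[WZhang2014] Lemma 8.4 (1), Thm. 9.1; [GrossLMS1991] Prop. 3.7 (2); [Kurihara2014] §5.3; [SilvermanAEC2009] III.2.3, VII.2.1,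
VII.3.1, X.4.2, X.5 Cor. 5.4; [CremonaAlgorithms1997] Table 1 (655a1), §3.6.
-/

set_option linter.dupNamespace false

noncomputable section

open scoped Classical NumberField

namespace Summit.BirchSwinnertonDyer.BirchSwinnertonDyer.Theorems.KolyvaginDepthDoor

open Literature.NumberTheory.EllipticCurves Literature.NumberTheory.EllipticCurves.ModularForms
  WeierstrassCurve NumberField IsDedekindDomain
open Summit.BirchSwinnertonDyer.BirchSwinnertonDyer.Theorems
open Summit.BirchSwinnertonDyer.BirchSwinnertonDyer.Rank2Observatory
open Summit.BirchSwinnertonDyer.BirchSwinnertonDyer.Rank1Residual (IntModel.frobeniusTrace_eq)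
open Summit.BirchSwinnertonDyer.Rank1Residual.Supersingular (natCard_point_eq_of_countPoints countPoints_eq_of_fast)
open Summit.BirchSwinnertonDyer.Rank1Residual.Additive (card_torsion_le_of_intModel_of_card
  isKolyvaginPrime_of_intModel_of_card)

namespace C655a1

/-! ## §1 The exact depth-one reading of row `655a1` at `(11, −51)` -/

/-- **THE EXACT DEPTH-ONE READING of row `655a1` @ `(11, −51)` in Kurihara currency.** Granted the E-side claim `hδE`
(record `cert_655a1` @ `(11, 617·727)`; with Kim Thm. 1.11 it gives `Ш(655a1)[11] = 0`) and the named facts displayed: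
for every `K` with `d_K = −51`, «some frame, some Kolyvagin PRIME `ℓ`, some Kolyvagin–Heegner datum of conductor `ℓ` with
`c_1(ℓ) ≠ 0`» holds IF AND ONLY IF «for every datum `D` of `T₀ = [0, 0, 1, -33813, -2420881]` at level `N_{T₀}` with `11 ∤ c_D`
and the period transfer, some cyclic Kolyvagin level `m` of `(T₀, 11)` with `ν(m) ≤ 1` carries a unit mod-`11` Kurihara number» —
g14's generic rank-two row (`kolyvaginClass_prime_ne_zero_iff_shaTrivial_twistSelmer_of_rank_two_of_lemma84`, (γ) + W. Zhang
by name, `rank 655a1 = 2` by the kernel 2-descent `Rank2Observatory.C655a1.mordellWeilRank_eq_two`) ∘ v18's twist IFF (Sakamoto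
Thm. 1.2/1.5 + Kim Thm. 1.11 + modularity + Mazur by name). CONDITIONAL on the seven named facts and the claim `hδE`; per curve;
BSD is not proved by it. [cite: Sakamoto2022pSelmer, Thm. 1.2, Thm. 1.5] [cite: Kim2022StructureSelmer, Thm. 1.11]
[cite: WZhang2014, Lemma 8.4 (1) (p. 236)] [cite: GrossLMS1991, Prop. 3.7 (2), §5 (5.1)] [cite: CremonaAlgorithms1997, Table 1 (655a1)] -/
theorem kolyvaginPrime_iff_twistKuriharaBit_11_neg51
    (h372 : GrossLMS1991.prop37_2_frobeniusCongruence)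
    (h84 : Literature.NumberTheory.EllipticCurves.WZhang2014_lemma84_exists_minimal_kolyvaginClass_one_selmerCard)
    (hKim : Kim2022_card_selmerGroup_le_pow_of_kuriharaNumber_ne_zero)
    (hSak1 : Sakamoto2022_card_selmerGroup_eq_pow_of_isDeltaMinimal)
    (hSak2 : Sakamoto2022_exists_cyclicLevel_kuriharaNumber_ne_zero)
    (hnf : exists_isNewformOf) (hMaz : mazur_not_dvd_maninConstant_of_odd)
    (K : Type) [Field K] [NumberField K] (hK : IsImaginaryQuadratic K) (hD : NumberField.discr K = -51)
    (hδE : haveI := isElliptic_c655a1; haveI := isGloballyMinimal_c655a1;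
      haveI : NeZero (((⟨0, 0, 1, -13, 18⟩ : WeierstrassCurve ℤ).map (Int.castRingHom ℚ)).conductorNorm ℤ) := neZero_conductorNorm_of_isElliptic _;
      haveI := Fact.mk (by norm_num : Nat.Prime 11);
      ∀ (D : ModularParametrizationData ((⟨0, 0, 1, -13, 18⟩ : WeierstrassCurve ℤ).map (Int.castRingHom ℚ)) (((⟨0, 0, 1, -13, 18⟩ : WeierstrassCurve ℤ).map (Int.castRingHom ℚ)).conductorNorm ℤ)), ¬ ((11 : ℕ) : ℤ) ∣ D.maninConstant →
        (∃ u : ℚ, ‖(u : ℚ_[11])‖ = 1 ∧ ((⟨0, 0, 1, -13, 18⟩ : WeierstrassCurve ℤ).map (Int.castRingHom ℚ)).realPeriodRat = u * plusPeriod D.f) →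
        ∃ ψ : (ℓ : ℕ) → (ZMod ℓ)ˣ →* Multiplicative (ZMod 11),
          (∀ ℓ ∈ (448559 : ℕ).primeFactors, Function.Surjective (ψ ℓ)) ∧ kuriharaNumber D.f 11 448559 ψ ≠ 0) :
    haveI := isElliptic_c655a1; haveI := isGloballyMinimal_c655a1;
    haveI : NeZero (((⟨0, 0, 1, -13, 18⟩ : WeierstrassCurve ℤ).map (Int.castRingHom ℚ)).conductorNorm ℤ) := neZero_conductorNorm_of_isElliptic _;
    haveI := minTwist51_isElliptic; haveI := minTwist51_isGloballyMinimal;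
    haveI : NeZero (((⟨0, 0, 1, -33813, -2420881⟩ : WeierstrassCurve ℤ).map (Int.castRingHom ℚ)).conductorNorm ℤ) := neZero_conductorNorm_of_isElliptic _;
    haveI := Fact.mk (by norm_num : Nat.Prime 11);
    (∃ (Dt : ModularParametrizationData ((⟨0, 0, 1, -13, 18⟩ : WeierstrassCurve ℤ).map (Int.castRingHom ℚ)) (((⟨0, 0, 1, -13, 18⟩ : WeierstrassCurve ℤ).map (Int.castRingHom ℚ)).conductorNorm ℤ)) (β : ℤ)
      (ι : K →+* ℂ) (ℓ : ℕ) (d : KolyvaginHeegnerData Dt β ι ℓ),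
      ℓ.Prime ∧ Zhang2014.IsKolyvaginPrime (((⟨0, 0, 1, -13, 18⟩ : WeierstrassCurve ℤ).map (Int.castRingHom ℚ)).conductorNorm ℤ) ((⟨0, 0, 1, -13, 18⟩ : WeierstrassCurve ℤ).map (Int.castRingHom ℚ)) K 11 ℓ ∧
        d.kolyvaginClass (p := 11) (by norm_num) 1 ≠ 0) ↔
    (∀ (D : ModularParametrizationData ((⟨0, 0, 1, -33813, -2420881⟩ : WeierstrassCurve ℤ).map (Int.castRingHom ℚ))
          (((⟨0, 0, 1, -33813, -2420881⟩ : WeierstrassCurve ℤ).map (Int.castRingHom ℚ)).conductorNorm ℤ)),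
        ¬ ((11 : ℕ) : ℤ) ∣ D.maninConstant →
        (∃ u : ℚ, ‖(u : ℚ_[11])‖ = 1 ∧
          ((⟨0, 0, 1, -33813, -2420881⟩ : WeierstrassCurve ℤ).map (Int.castRingHom ℚ)).realPeriodRat = u * plusPeriod D.f) →
        ∃ (m : ℕ) (_ : NeZero m), IsCyclicKolyvaginLevel ((⟨0, 0, 1, -33813, -2420881⟩ : WeierstrassCurve ℤ).map (Int.castRingHom ℚ)) 11 m ∧
          m.primeFactors.card ≤ 1 ∧
          ∃ ψ : (ℓ : ℕ) → (ZMod ℓ)ˣ →* Multiplicative (ZMod 11),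
            (∀ ℓ ∈ m.primeFactors, Function.Surjective (ψ ℓ)) ∧ kuriharaNumber D.f 11 m ψ ≠ 0) := by
  haveI := isElliptic_c655a1
  haveI := isGloballyMinimal_c655a1
  haveI iNZ : NeZero (((⟨0, 0, 1, -13, 18⟩ : WeierstrassCurve ℤ).map (Int.castRingHom ℚ)).conductorNorm ℤ) :=
    neZero_conductorNorm_of_isElliptic _
  haveI := minTwist51_isElliptic
  haveI := minTwist51_isGloballyMinimal
  haveI iNZT : NeZero (((⟨0, 0, 1, -33813, -2420881⟩ : WeierstrassCurve ℤ).map (Int.castRingHom ℚ)).conductorNorm ℤ) :=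
    neZero_conductorNorm_of_isElliptic _
  haveI iP := Fact.mk (by norm_num : Nat.Prime 11)
  have hsha := sha_inf_torsionBy_eq_bot_of_kuriharaClaim_11 hKim hnf hMaz hδE
  have hsur : ((⟨0, 0, 1, -13, 18⟩ : WeierstrassCurve ℤ).map (Int.castRingHom ℚ)).HasSurjectiveModNGaloisRep ((11 : ℕ) : ℤ) := by
    simpa using hasSurjectiveModNGaloisRep_11
  have hpD : ¬ (((11 : ℕ) : ℤ) ∣ NumberField.discr K) := by rw [hD]; decide
  have hC : (⟨1, (0 : ℚ), (0 : ℚ), -((1 : ℚ) / 2)⟩ : WeierstrassCurve.VariableChange ℚ) • ((⟨0, 0, 1, -33813, -2420881⟩ : WeierstrassCurve ℤ).map (Int.castRingHom ℚ)) =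
      ((⟨0, 0, 1, -13, 18⟩ : WeierstrassCurve ℤ).map (Int.castRingHom ℚ)).quadraticTwist ((NumberField.discr K : ℤ) : ℚ) := by
    rw [hD]; push_cast; exact minTwist51_smul_eq
  have htower : ∀ k : ℕ, ((⟨0, 0, 1, -13, 18⟩ : WeierstrassCurve ℤ).map (Int.castRingHom ℚ)).HasSurjectiveModNGaloisRep ((11 : ℕ) ^ k : ℕ) :=
    serre_hasSurjectiveModNGaloisRep_pow_holds _ 11 (by norm_num) hsur
  have hsp := spadeOne_of_five_le 11 (by norm_num)
  have hS2 : ¬ Squarefree (((⟨0, 0, 1, -13, 18⟩ : WeierstrassCurve ℤ).map (Int.castRingHom ℚ)).conductorNorm ℤ) →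
      (∃ (ℓ : ℕ) (_ : Fact ℓ.Prime), ((⟨0, 0, 1, -13, 18⟩ : WeierstrassCurve ℤ).map (Int.castRingHom ℚ)).HasMultiplicativeReductionAtPrime ℓ ∧
          ¬ 11 ∣ padicValInt ℓ ((⟨0, 0, 1, -13, 18⟩ : WeierstrassCurve ℤ).map (Int.castRingHom ℚ)).minimalDiscriminantInt) ∧
        ∃ (ℓ₁ ℓ₂ : ℕ) (_ : Fact ℓ₁.Prime) (_ : Fact ℓ₂.Prime), ℓ₁ ≠ ℓ₂ ∧
          ((⟨0, 0, 1, -13, 18⟩ : WeierstrassCurve ℤ).map (Int.castRingHom ℚ)).HasMultiplicativeReductionAtPrime ℓ₁ ∧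
          ((⟨0, 0, 1, -13, 18⟩ : WeierstrassCurve ℤ).map (Int.castRingHom ℚ)).HasMultiplicativeReductionAtPrime ℓ₂ :=
    fun hns ↦ absurd ((((⟨0, 0, 1, -13, 18⟩ : WeierstrassCurve ℤ).map (Int.castRingHom ℚ))).isSemistable_iff_squarefree_conductorNorm.mp hsp.2) hns
  have hH := satisfiesHeegnerHypothesis_conductorNorm_of_intModel intModel K hK.1 hD heegner_neg51
  have hD3 : NumberField.discr K ≠ -3 := by rw [hD]; norm_num
  have hD4 : NumberField.discr K ≠ -4 := by rw [hD]; norm_num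
  have hr2 := Summit.BirchSwinnertonDyer.BirchSwinnertonDyer.Rank2Observatory.C655a1.mordellWeilRank_eq_two
  have hT := natCard_selmerGroup_quadraticTwist_le_iff_kuriharaBit hKim hSak1 hSak2 hnf hMaz _ 11 (by norm_num) goodOrdinary_11.1
    goodOrdinary_11.2 hsur (NumberField.discr_ne_zero K) hpD _ _ hC minTwist51_nonAnomalous_11
    (minTwist51_kodairaNeron_of_five_le 11 (by norm_num)) 1
  rw [pow_one] at hT
  rw [kolyvaginClass_prime_ne_zero_iff_shaTrivial_twistSelmer_of_rank_two_of_lemma84 h372 h84 _ not_hasCM 11 (by norm_num)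
    goodOrdinary_11.1 goodOrdinary_11.2 htower (kodairaNeron_of_five_le 11 (by norm_num)) hsp.1 hS2 K hK hD3 hD4 hpD hH hr2,
    and_iff_right hsha]
  exact hT

/-! ## §2 Kernel: `89` is a cyclic Kolyvagin prime of `(T₀, 11)` at which the tree's twist point is locally `11`-indivisible -/

/-- `#T̃₀(𝔽_89) = 99 = 11·9` for `T₀ = [0, 0, 1, -33813, -2420881]` (`89 ≡ 1 (mod 11)`, `a_89(T₀) = -9 ≡ 2 (mod 11)`, `11² ∤ 99`),
kernel-decided (`countPointsFast`). [cite: Kim2022StructureSelmer, §1.2.2 (PDF p. 5)] -/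
theorem minTwist51_card_89 :
    Nat.card (((⟨0, 0, 1, -33813, -2420881⟩ : WeierstrassCurve ℤ).map (Int.castRingHom (ZMod 89))).toAffine.Point) = 99 :=
  haveI : Fact (Nat.Prime 89) := ⟨by norm_num⟩
  natCard_point_eq_of_countPoints 0 0 1 (-33813) (-2420881) 89 (by norm_num) (by decide +kernel) (n := 99)
    (countPoints_eq_of_fast (by decide +kernel))

/-- **`89` is a CYCLIC KOLYVAGIN PRIME for `(T₀, 11)`** (`89 ∤ 11·N_{T₀}`, `89 ≡ 1`, `a_89(T₀) ≡ 2 (mod 11)`, `#T̃₀(𝔽_89)[11] ≤ 11`).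
[cite: Kim2022StructureSelmer, §1.2.2 (PDF p. 5)] -/
theorem minTwist51_isCyclicKolyvaginLevel_11_89 :
    haveI := minTwist51_isGloballyMinimal; haveI := Fact.mk (by norm_num : Nat.Prime 11);
    IsCyclicKolyvaginLevel ((⟨0, 0, 1, -33813, -2420881⟩ : WeierstrassCurve ℤ).map (Int.castRingHom ℚ)) 11 89 := by
  haveI := minTwist51_isElliptic
  haveI := minTwist51_isGloballyMinimal
  haveI := Fact.mk (by norm_num : Nat.Prime 11)
  haveI : Fact (Nat.Prime 89) := ⟨by norm_num⟩
  have hℓ : Kato.IsKolyvaginPrime ((⟨0, 0, 1, -33813, -2420881⟩ : WeierstrassCurve ℤ).map (Int.castRingHom ℚ)) 11 1 89 :=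
    isKolyvaginPrime_of_intModel_of_card minTwist51_intModel 11 1 89 (by norm_num) (by decide +kernel) (by decide)
      minTwist51_card_89 (by norm_num)
  refine ⟨⟨Nat.squarefree_iff_nodup_primeFactorsList (by norm_num) |>.mpr (by simp), fun ℓ hℓ' ↦ ?_⟩, fun ℓ hℓ' hdvd ↦ ?_⟩
  · rw [show (89 : ℕ).primeFactors = {89} from (Nat.Prime.primeFactors (by norm_num)), Finset.mem_singleton] at hℓ'
    exact hℓ' ▸ hℓ
  · obtain rfl := (Nat.prime_dvd_prime_iff_eq hℓ'.out (by norm_num)).mp hdvd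
    exact card_torsion_le_of_intModel_of_card minTwist51_intModel 11 89 minTwist51_card_89 (by norm_num)

/-- The rational point `P = (3844729/16, 7538734893/64)` of `T₀ = [0, 0, 1, -33813, -2420881]` (denominators powers of primes `≠ 89`; on the curve). [folklore] -/
theorem minTwist51_nonsingular_P :
    ((⟨0, 0, 1, -33813, -2420881⟩ : WeierstrassCurve ℤ).map (Int.castRingHom ℚ)).toAffine.Nonsingular ((3844729 : ℚ) / 16) ((7538734893 : ℚ) / 64) :=
  nonsingular_rat_of_eq_rat _ (by decide +kernel) (by norm_num)

/-- The double-and-add chain from `P̄` reaches the multiplier `9`. [folklore] -/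
theorem chain89_mult :
    chainMult 1 [(true, ((84 : ℤ) : ZMod 89), ((46 : ℤ) : ZMod 89)), (true, ((52 : ℤ) : ZMod 89), ((75 : ℤ) : ZMod 89)), (true, ((19 : ℤ) : ZMod 89), ((38 : ℤ) : ZMod 89)), (false, ((59 : ℤ) : ZMod 89), ((74 : ℤ) : ZMod 89))] = 9 := by
  decide

/-- The double-and-add chain from `P̄ = (79, 2)` to `9 • P̄ = (59, 74)` in `T̃₀(𝔽_89)` CHECKS (tangent / chord
certificates, `decide`). [cite: SilvermanAEC2009, III.2.3] -/
theorem chain89_ok :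
    chainB (⟨0, 0, 1, -33813, -2420881⟩ : WeierstrassCurve ℤ) 89 (((79 : ℤ)) : ZMod 89) (((2 : ℤ)) : ZMod 89)
      ((((79 : ℤ)) : ZMod 89), (((2 : ℤ)) : ZMod 89))
      [(true, ((84 : ℤ) : ZMod 89), ((46 : ℤ) : ZMod 89)), (true, ((52 : ℤ) : ZMod 89), ((75 : ℤ) : ZMod 89)), (true, ((19 : ℤ) : ZMod 89), ((38 : ℤ) : ZMod 89)), (false, ((59 : ℤ) : ZMod 89), ((74 : ℤ) : ZMod 89))] = true := by
  decide +kernel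

/-- **KERNEL: `P = (3844729/16, 7538734893/64)` is not divisible by `11` in `T₀(ℚ_89)`** — the chain certifies `9 • P̄ ≠ O` in
`T̃₀(𝔽_89)` for the reduction `P̄ = (79, 2)`, `11·9 = #T̃₀(𝔽_89)`, and `localNondivisible_of_chainB_rat`.
[cite: SilvermanAEC2009, III.2.3, VII.2 Prop. 2.1, VII.3 Prop. 3.1] -/
theorem minTwist51_localNondivisible_89 :
    haveI : Fact (Nat.Prime 89) := ⟨by norm_num⟩;
    ∀ Q : (((⟨0, 0, 1, -33813, -2420881⟩ : WeierstrassCurve ℤ).map (Int.castRingHom ℚ)).baseChange ℚ_[89]).toAffine.Point,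
      11 • Q ≠ WeierstrassCurve.Affine.Point.map (W' := ((⟨0, 0, 1, -33813, -2420881⟩ : WeierstrassCurve ℤ).map (Int.castRingHom ℚ)).toAffine)
        (S := ℚ) (Algebra.ofId ℚ ℚ_[89]) (.some ((3844729 : ℚ) / 16) ((7538734893 : ℚ) / 64) minTwist51_nonsingular_P) := by
  haveI : Fact (Nat.Prime 89) := ⟨by norm_num⟩
  have hq : ¬ ((89 : ℕ) : ℤ) ∣ (⟨0, 0, 1, -33813, -2420881⟩ : WeierstrassCurve ℤ).Δ := by decide +kernel
  have hx : ¬ (89 : ℕ) ∣ (((3844729 : ℚ) / 16)).den := by decide +kernel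
  have hy : ¬ (89 : ℕ) ∣ (((7538734893 : ℚ) / 64)).den := by decide +kernel
  have hm : ((89 : ℕ) : ℤ) ∣ (((3844729 : ℚ) / 16)).num - (79 : ℤ) * (((3844729 : ℚ) / 16)).den := by decide +kernel
  have hm' : ((89 : ℕ) : ℤ) ∣ (((7538734893 : ℚ) / 64)).num - (2 : ℤ) * (((7538734893 : ℚ) / 64)).den := by decide +kernel
  have hpk : 11 * 9 = Nat.card (((⟨0, 0, 1, -33813, -2420881⟩ : WeierstrassCurve ℤ).map (Int.castRingHom (ZMod 89))).toAffine.Point) := by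
    rw [minTwist51_card_89]
  exact localNondivisible_of_chainB_rat (⟨0, 0, 1, -33813, -2420881⟩ : WeierstrassCurve ℤ) 89 hq minTwist51_nonsingular_P hx hy hm hm' hpk
    chain89_mult (by convert chain89_ok)


/-! ## §3 The decisive prime -/

/-- **ROW `655a1` @ `(11, -51)`: THE DECISIVE PRIME `89` — bit ⟺ unit `δ̃_89(T₀)`.** For every imaginary quadratic `K`
with `d_K = -51`, granted the named facts displayed and the E-side record claim `hδE`: «some frame, some Kolyvagin PRIME
`ℓ`, some Kolyvagin–Heegner datum of conductor `ℓ` with `c_1(ℓ) ≠ 0`» (the depth-table bit) holds IF AND ONLY IF «every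
datum `D` of `T₀` at level `N_{T₀}` with `11 ∤ c_D` and the period transfer has a UNIT mod-`11` Kurihara number AT `89`» —
the claim of a future tree record `cert_<T₀>` @ `(11, 89)`. (⟹): bit ⟹ `#Sel_11(E^{(-51)}) ≤ 11` (§1 ∘ v18's twist IFF)
⟹ unit at `89` (`twistKuriharaClaim_prime_of_natCard_selmerGroup_le` with the kernel certificate `minTwist51_localNondivisible_89`);
(⟸): §1 with `m = 89` (`minTwist51_isCyclicKolyvaginLevel_11_89`, `ν(89) = 1`). CONDITIONAL on the named facts and the claim;
per curve; BSD is not proved by it. [cite: Sakamoto2022pSelmer, Lemma 4.4, Lemma 4.6 (1), Thm. 1.2, Thm. 1.5]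
[cite: Kim2022StructureSelmer, Thm. 1.11] [cite: CremonaAlgorithms1997, Table 1 (655a1)] -/
theorem twistKuriharaBit_iff_unit_89
    (h372 : GrossLMS1991.prop37_2_frobeniusCongruence)
    (h84 : Literature.NumberTheory.EllipticCurves.WZhang2014_lemma84_exists_minimal_kolyvaginClass_one_selmerCard)
    (hKim : Kim2022_card_selmerGroup_le_pow_of_kuriharaNumber_ne_zero)
    (hSak1 : Sakamoto2022_card_selmerGroup_eq_pow_of_isDeltaMinimal)
    (hSak2 : Sakamoto2022_exists_cyclicLevel_kuriharaNumber_ne_zero)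
    (hSak3 : Literature.NumberTheory.EllipticCurves.Sakamoto2022_kuriharaNumber_prime_ne_zero_of_localNondivisible)
    (hnf : exists_isNewformOf) (hMaz : mazur_not_dvd_maninConstant_of_odd)
    (K : Type) [Field K] [NumberField K] (hK : IsImaginaryQuadratic K) (hD : NumberField.discr K = -51)
    (hδE : haveI := isElliptic_c655a1; haveI := isGloballyMinimal_c655a1;
      haveI : NeZero (((⟨0, 0, 1, -13, 18⟩ : WeierstrassCurve ℤ).map (Int.castRingHom ℚ)).conductorNorm ℤ) := neZero_conductorNorm_of_isElliptic _;
      haveI := Fact.mk (by norm_num : Nat.Prime 11);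
      ∀ (D : ModularParametrizationData ((⟨0, 0, 1, -13, 18⟩ : WeierstrassCurve ℤ).map (Int.castRingHom ℚ)) (((⟨0, 0, 1, -13, 18⟩ : WeierstrassCurve ℤ).map (Int.castRingHom ℚ)).conductorNorm ℤ)), ¬ ((11 : ℕ) : ℤ) ∣ D.maninConstant →
        (∃ u : ℚ, ‖(u : ℚ_[11])‖ = 1 ∧ ((⟨0, 0, 1, -13, 18⟩ : WeierstrassCurve ℤ).map (Int.castRingHom ℚ)).realPeriodRat = u * plusPeriod D.f) →
        ∃ ψ : (ℓ : ℕ) → (ZMod ℓ)ˣ →* Multiplicative (ZMod 11),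
          (∀ ℓ ∈ (448559 : ℕ).primeFactors, Function.Surjective (ψ ℓ)) ∧ kuriharaNumber D.f 11 448559 ψ ≠ 0) :
    haveI := isElliptic_c655a1; haveI := isGloballyMinimal_c655a1;
    haveI : NeZero (((⟨0, 0, 1, -13, 18⟩ : WeierstrassCurve ℤ).map (Int.castRingHom ℚ)).conductorNorm ℤ) := neZero_conductorNorm_of_isElliptic _;
    haveI := minTwist51_isElliptic; haveI := minTwist51_isGloballyMinimal;
    haveI : NeZero (((⟨0, 0, 1, -33813, -2420881⟩ : WeierstrassCurve ℤ).map (Int.castRingHom ℚ)).conductorNorm ℤ) := neZero_conductorNorm_of_isElliptic _;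
    haveI := Fact.mk (by norm_num : Nat.Prime 11);
    (∃ (Dt : ModularParametrizationData ((⟨0, 0, 1, -13, 18⟩ : WeierstrassCurve ℤ).map (Int.castRingHom ℚ)) (((⟨0, 0, 1, -13, 18⟩ : WeierstrassCurve ℤ).map (Int.castRingHom ℚ)).conductorNorm ℤ)) (β : ℤ)
      (ι : K →+* ℂ) (ℓ : ℕ) (d : KolyvaginHeegnerData Dt β ι ℓ),
      ℓ.Prime ∧ Zhang2014.IsKolyvaginPrime (((⟨0, 0, 1, -13, 18⟩ : WeierstrassCurve ℤ).map (Int.castRingHom ℚ)).conductorNorm ℤ) ((⟨0, 0, 1, -13, 18⟩ : WeierstrassCurve ℤ).map (Int.castRingHom ℚ)) K 11 ℓ ∧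
        d.kolyvaginClass (p := 11) (by norm_num) 1 ≠ 0) ↔
    (∀ (D : ModularParametrizationData ((⟨0, 0, 1, -33813, -2420881⟩ : WeierstrassCurve ℤ).map (Int.castRingHom ℚ))
          (((⟨0, 0, 1, -33813, -2420881⟩ : WeierstrassCurve ℤ).map (Int.castRingHom ℚ)).conductorNorm ℤ)),
        ¬ ((11 : ℕ) : ℤ) ∣ D.maninConstant →
        (∃ u : ℚ, ‖(u : ℚ_[11])‖ = 1 ∧
          ((⟨0, 0, 1, -33813, -2420881⟩ : WeierstrassCurve ℤ).map (Int.castRingHom ℚ)).realPeriodRat = u * plusPeriod D.f) →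
        ∃ ψ : (q : ℕ) → (ZMod q)ˣ →* Multiplicative (ZMod 11),
          (∀ q ∈ (89 : ℕ).primeFactors, Function.Surjective (ψ q)) ∧ kuriharaNumber D.f 11 89 ψ ≠ 0) := by
  haveI := isElliptic_c655a1
  haveI := isGloballyMinimal_c655a1
  haveI iNZ : NeZero (((⟨0, 0, 1, -13, 18⟩ : WeierstrassCurve ℤ).map (Int.castRingHom ℚ)).conductorNorm ℤ) :=
    neZero_conductorNorm_of_isElliptic _
  haveI := minTwist51_isElliptic
  haveI := minTwist51_isGloballyMinimal
  haveI iNZT : NeZero (((⟨0, 0, 1, -33813, -2420881⟩ : WeierstrassCurve ℤ).map (Int.castRingHom ℚ)).conductorNorm ℤ) :=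
    neZero_conductorNorm_of_isElliptic _
  haveI iP := Fact.mk (by norm_num : Nat.Prime 11)
  haveI : Fact (Nat.Prime 89) := ⟨by norm_num⟩
  haveI : NeZero (89 : ℕ) := ⟨by norm_num⟩
  have hsur : ((⟨0, 0, 1, -13, 18⟩ : WeierstrassCurve ℤ).map (Int.castRingHom ℚ)).HasSurjectiveModNGaloisRep ((11 : ℕ) : ℤ) := by
    simpa using hasSurjectiveModNGaloisRep_11
  have hpD : ¬ (((11 : ℕ) : ℤ) ∣ NumberField.discr K) := by rw [hD]; decide
  have hC : (⟨1, (0 : ℚ), (0 : ℚ), -((1 : ℚ) / 2)⟩ : WeierstrassCurve.VariableChange ℚ) • ((⟨0, 0, 1, -33813, -2420881⟩ : WeierstrassCurve ℤ).map (Int.castRingHom ℚ)) =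
      ((⟨0, 0, 1, -13, 18⟩ : WeierstrassCurve ℤ).map (Int.castRingHom ℚ)).quadraticTwist ((NumberField.discr K : ℤ) : ℚ) := by
    rw [hD]; push_cast; exact minTwist51_smul_eq
  have hiff := kolyvaginPrime_iff_twistKuriharaBit_11_neg51 h372 h84 hKim hSak1 hSak2 hnf hMaz K hK hD hδE
  constructor
  · intro hbit D hc hu
    have hT := (natCard_selmerGroup_quadraticTwist_le_iff_kuriharaBit hKim hSak1 hSak2 hnf hMaz _ 11 (by norm_num) goodOrdinary_11.1
      goodOrdinary_11.2 hsur (NumberField.discr_ne_zero K) hpD _ _ hC minTwist51_nonAnomalous_11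
      (minTwist51_kodairaNeron_of_five_le 11 (by norm_num)) 1).mpr (hiff.mp hbit)
    rw [pow_one] at hT
    exact twistKuriharaClaim_prime_of_natCard_selmerGroup_le hSak3 _ 11 (by norm_num) goodOrdinary_11.1 goodOrdinary_11.2 hsur
      (NumberField.discr_ne_zero K) hpD _ _ hC minTwist51_nonAnomalous_11 (minTwist51_kodairaNeron_of_five_le 11 (by norm_num)) hT 89
      minTwist51_isCyclicKolyvaginLevel_11_89 _ minTwist51_localNondivisible_89 D hc hu
  · intro hunit
    refine hiff.mpr fun D hc hu ↦ ?_
    obtain ⟨ψ, hψ, hne⟩ := hunit D hc hu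
    refine ⟨89, inferInstance, minTwist51_isCyclicKolyvaginLevel_11_89, ?_, ψ, hψ, hne⟩
    rw [Nat.Prime.primeFactors (by norm_num), Finset.card_singleton]

end C655a1

end Summit.BirchSwinnertonDyer.BirchSwinnertonDyer.Theorems.KolyvaginDepthDoor

end
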